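import Literature.AlgebraicGeometry.AbelianSchemes.DualPairOfGluedHatUnique
import Literature.AlgebraicGeometry.AbelianSchemes.RigidifiedLineBundleSliceHomogeneous
import Literature.AlgebraicGeometry.AbelianSchemes.FibrewisePicZeroDescendsAlongSurjection
import HarnessLib

/-!
# (Z3) FILE P-b, letter (F): the glued Poincaré sheaf is FIBREWISE IN `Pic⁰` over the glued hat

Layer `Literature/AlgebraicGeometry/AbelianSchemes`, namespace `Literature.AlgebraicGeometry.AbelianSchemes.AbelianSchemeOver`.
THEOREMS ONLY (no definition, no named fact, no instance, no notation, no `sorry`).  Cell hodgecm-mathlib (D-0151), FLOOR 0 P1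
sub-line `Cruxes/HDel/Lines/F3DualAbelianScheme.lean` stub (Z) `stub_F3Z`; FILE P-b letter (F) of the skeleton
`B-provers/B-p06/g14/F3/DualPairOfGluedHat.SKELETON-v2-3sorry.B-p06g14.lean` (B-p06 (g14)), discharged here.

SETTING as in ★-shaped `DualPairOfGluedHatUnique` (product charts `Ξᵢ = prodChart i : Aᵢ ×_{Uᵢ} Êᵢ → A ×_S H` of a hat `H` with
CARTESIAN charts `χᵢ : Êᵢ → H` over an open cover `𝒰` of `S`, chart dual pairs `Eᵢ` of `Aᵢ = A ×_S Uᵢ`).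

* `exists_fac_openCover` — a field-valued point of `S` factors through a member of the cover (`Spec Ω` is one point; pattern of ★
  `ZariskiGluingDatum.exists_fac`);
* `sliceOver_comp_prodChart` — the fibre slice of `A ×_S H` at a geometric point `b` of `H` lifted to the chart `Êᵢ ∋ β ↦ b`:
  `(Eᵢ.sliceOver β s′) ≫ Ξᵢ = (fibre comparison isos) ≫ A.fibreSlice H b` (Mathlib `pullback.hom_ext`; ★ `fibreBaseChangeIso`, ★ `fibreCongrIso`);
* **`isHomogeneous_fibreSlice_of_charts`** — letter (F): if `Ξᵢ^*P′ ≅ 𝒫ᵢ` for all `i`, the slice of `P′` over every geometric point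
  `b` of `H` is translation invariant ([MumfordAV1970, §8 (iv) ⇔ (i)]): `b` lies over some `Uᵢ`, hence factors through `Êᵢ` by the
  cartesian `χᵢ` (Mathlib `IsPullback.lift`); there the slice of `P′` is the slice of `𝒫ᵢ`, homogeneous by `Eᵢ.fibrewisePicZero`
  (★ `DualPair.isHomogeneous_pullback_sliceOver`), and homogeneity moves along isomorphisms of abelian varieties and of modules
  (★ `isHomogeneous_pullback_iff_of_iso`, ★ `isHomogeneous_iff_of_iso`).

HC_CM is proved only modulo the 7 printed citations until rung 0 closes; this file discharges none of them (count-neutral capital).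

## References
* [MumfordAV1970] D. Mumford, *Abelian Varieties* (1970), §8 ((iv) ⇔ (i)) (`Pic⁰` = translation-invariant line bundles).
* [MilneAV2008] J. S. Milne, *Abelian Varieties* (v2.00, 2008), I §8 pp. 36–37 (condition (a) of the dual pair).
* [GortzWedhorn2020] U. Görtz, T. Wedhorn, *Algebraic Geometry I*, 2nd ed. (2020), Section (3.3) Prop. 3.5; Section (4.7) (pp. 107–108).
-/

set_option autoImplicit false

-- `Scheme.Modules` / the `Over`-structure maps of ★ `baseChange` are not reducible (as in ★ `PoincareUniversalLocality`).
set_option backward.isDefEq.respectTransparency false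

noncomputable section

universe u

open CategoryTheory CategoryTheory.Limits AlgebraicGeometry MonoidalCategory
open Literature.AlgebraicGeometry.Motives Literature.AlgebraicGeometry.AbelianVarieties Literature.AlgebraicGeometry.Modules

namespace Literature.AlgebraicGeometry.AbelianSchemes

namespace AbelianSchemeOver

variable {S : Scheme.{u}} (A : AbelianSchemeOver S) (𝒰 : Scheme.OpenCover.{u} S)
  (E : ∀ i, (A.baseChange (𝒰.f i)).DualPair) (H : AbelianSchemeOver S) (χ : ∀ i, (E i).hat.X.left ⟶ H.X.left)
  (hχ : ∀ i, (E i).hat.IsBaseChangeVia H (𝒰.f i) (χ i))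

/-- **Every field-valued point of `S` factors through a member of the open cover** (`Spec Ω` is one point; open immersions
lift — pattern of ★ `ZariskiGluingDatum.exists_fac`). [cite: GortzWedhorn2020, Section (3.3) Proposition 3.5] -/
theorem exists_fac_openCover {Ω : Type u} [Field Ω] (s : Spec (.of Ω) ⟶ S) :
    ∃ (i : 𝒰.I₀) (s' : Spec (.of Ω) ⟶ 𝒰.X i), s' ≫ 𝒰.f i = s := by
  obtain ⟨i, y, hy⟩ := 𝒰.exists_eq (s.base default)
  refine ⟨i, IsOpenImmersion.lift (𝒰.f i) s ?_, IsOpenImmersion.lift_fac _ _ _⟩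
  rintro _ ⟨x, rfl⟩
  obtain rfl := Subsingleton.elim x default
  exact ⟨y, hy⟩

/-- **The chart square on fibre slices**: for a geometric point `b` of `H` over `s′ : Spec Ω → Uᵢ` with chart lift `β : Spec Ω → Êᵢ`
(`β ≫ χᵢ = b`), `(Eᵢ.sliceOver β s′) ≫ Ξᵢ = φ₂ ≫ φ₁ ≫ A.fibreSlice H b`, where `φ₂ : (Aᵢ)_{s′} ≅ A_{s′ ≫ (Uᵢ → S)}` is ★ `fibreBaseChangeIso`
and `φ₁ : A_{s′ ≫ (Uᵢ → S)} ≅ A_{b ≫ π_H}` is ★ `fibreCongrIso` (components in `A` and in `H`, Mathlib `pullback.hom_ext`).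
[cite: GortzWedhorn2020, Section (4.7) (pp. 107–108)] [cite: MilneAV2008, I §8 pp. 36–37] -/
theorem sliceOver_comp_prodChart (i : 𝒰.I₀) {Ω : Type u} [Field Ω] (b : Spec (.of Ω) ⟶ H.X.left)
    (s' : Spec (.of Ω) ⟶ 𝒰.X i) (hs : s' ≫ 𝒰.f i = b ≫ H.X.hom) (β : Spec (.of Ω) ⟶ (E i).hat.X.left)
    (hβχ : β ≫ χ i = b) (hβ : β ≫ (E i).hat.X.hom = s') :
    (E i).sliceOver β s' hβ ≫ A.prodChart 𝒰 E H χ hχ i =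
      AbelianVariety.Hom.toSchemeHom (A.fibreBaseChangeIso (𝒰.f i) s').hom ≫
        AbelianVariety.Hom.toSchemeHom (A.fibreCongrIso hs).hom ≫ A.fibreSlice H b := by
  apply pullback.hom_ext
  · rw [Category.assoc, prodChart_fst, DualPair.sliceOver_fst_assoc, Category.assoc, Category.assoc, fibreSlice_fst,
      fibreCongrIso_hom_toSchemeHom_fst, fibreBaseChangeIso_hom_toSchemeHom_fst]
    rfl
  · rw [Category.assoc, prodChart_snd, DualPair.sliceOver_snd_assoc, Category.assoc, Category.assoc, fibreSlice_snd,
      fibreCongrIso_hom_toSchemeHom_snd_assoc, fibreBaseChangeIso_hom_toSchemeHom_snd_assoc, hβχ]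
    rfl

/-- **Letter (F) — THE GLUED POINCARÉ SHEAF IS FIBREWISE IN `Pic⁰`.**  If `P′` on `A ×_S H` pulls back to the chart Poincaré sheaf
`𝒫ᵢ` along every product chart `Ξᵢ`, then for every geometric point `b : Spec Ω → H` the slice `P′|_{A_s × {b}}` (`s = b ≫ π_H`) is
translation invariant: `b` lies over some `Uᵢ` (`exists_fac_openCover`), so it factors through `Êᵢ` (cartesian `χᵢ`, Mathlib
`IsPullback.lift`); along `sliceOver_comp_prodChart` the slice of `P′` is the slice of `𝒫ᵢ`, which is homogeneous (★
`DualPair.isHomogeneous_pullback_sliceOver`), and homogeneity moves along the fibre isomorphisms (★ `isHomogeneous_pullback_iff_of_iso`) and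
module isomorphisms (★ `isHomogeneous_iff_of_iso`). [cite: MumfordAV1970, §8 ((iv) ⇔ (i))] [cite: MilneAV2008, I §8 pp. 36–37] -/
theorem isHomogeneous_fibreSlice_of_charts (P' : (A.prodLeft H).Modules)
    (hP : ∀ i, Nonempty ((Scheme.Modules.pullback (A.prodChart 𝒰 E H χ hχ i)).obj P' ≅ (E i).P))
    (Ω : Type u) [Field Ω] [IsAlgClosed Ω] (b : Spec (.of Ω) ⟶ H.X.left) :
    IsHomogeneous (A.fibre (b ≫ H.X.hom)).toAbelianVariety ((Scheme.Modules.pullback (A.fibreSlice H b)).obj P') := by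
  obtain ⟨i, s', hs⟩ := exists_fac_openCover 𝒰 (b ≫ H.X.hom)
  obtain ⟨w, hpb, -, -⟩ := hχ i
  -- the chart lift `β : Spec Ω → Êᵢ` of `b` through the cartesian `χᵢ`
  let β := hpb.lift b s' (by rw [hs])
  have hβχ : β ≫ χ i = b := hpb.lift_fst _ _ _
  have hβ : β ≫ (E i).hat.X.hom = s' := hpb.lift_snd _ _ _
  obtain ⟨c⟩ := hP i
  -- the slice of `𝒫ᵢ` over `β`, presented over `s′`, is homogeneous; hence so is the slice of `Ξᵢ^*P′`
  have h0 : IsHomogeneous ((A.baseChange (𝒰.f i)).fibre s').toAbelianVariety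
      ((Scheme.Modules.pullback ((E i).sliceOver β s' hβ)).obj
        ((Scheme.Modules.pullback (A.prodChart 𝒰 E H χ hχ i)).obj P')) :=
    (isHomogeneous_iff_of_iso _ ((Scheme.Modules.pullback ((E i).sliceOver β s' hβ)).mapIso c.symm)).1
      ((E i).isHomogeneous_pullback_sliceOver β hβ)
  -- move along `φ₁ : A_{s′ ≫ fᵢ} ≅ A_{b ≫ π_H}` and `φ₂ : (Aᵢ)_{s′} ≅ A_{s′ ≫ fᵢ}`
  refine (isHomogeneous_pullback_iff_of_iso (A.fibreCongrIso hs) _).1 ?_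
  refine (isHomogeneous_pullback_iff_of_iso (A.fibreBaseChangeIso (𝒰.f i) s') _).1 ?_
  refine (isHomogeneous_iff_of_iso _ ?_).1 h0
  -- `sliceOver^* Ξᵢ^* P′ ≅ (sliceOver ≫ Ξᵢ)^* P′ = (φ₂ ≫ φ₁ ≫ fibreSlice)^* P′ ≅ φ₂^* φ₁^* fibreSlice^* P′`
  exact (Scheme.Modules.pullbackComp _ _).app P' ≪≫
    (Scheme.Modules.pullbackCongr (A.sliceOver_comp_prodChart 𝒰 E H χ hχ i b s' hs β hβχ hβ)).app P' ≪≫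
    ((Scheme.Modules.pullbackComp _ _).app P').symm ≪≫
    (Scheme.Modules.pullback _).mapIso ((Scheme.Modules.pullbackComp _ _).app P').symm

end AbelianSchemeOver

end Literature.AlgebraicGeometry.AbelianSchemes

end
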